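import Summits.CriticalPhenomena.CardyFormulaZ2.Theorems.CardyComplexConeEdgePrecompactUFRSEvents

/-!
# Discretisation of the collar of a rectangle and the finite set of marked midpoints
(line `qkz-strip-boundary-arm` of crux `CardyComplexCone.EdgePrecompact`, stmt-CriticalPhenomena-11387;
second support file of the registered sub-goal `ufrs_screenedCollarDecay_rect`, M3 of the UFRS road map)

Elementary geometry for the union bound over the `3η`-collar of an open axis-parallel rectangle
`(x₀, x₁) × (y₀, y₁)`:

* `exists_gridIndex` — the arithmetic progression `y₀ + j s`, `s = (y₁ - y₀)/⌈(y₁ - y₀)/η⌉ ≤ η`,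
  `0 ≤ j ≤ ⌈(y₁ - y₀)/η⌉`, is `η`-dense in `[y₀, y₁)`;
* `card_filter_dist_le` — at most `2T/s + 1` points of a progression of step `s` (in one
  coordinate) lie within distance `T` of a given point;
* `exists_boundaryGrid` — **the boundary grid**: a finite set `G` of at most
  `(2(x₁ - x₀) + 2(y₁ - y₀))/η + 8` points of the topological boundary of the rectangle such that
  every point `z` of the rectangle with `infDist z (rectangle)ᶜ < 3η` is within `4η` of a point of
  `G`, and at most `16 T/η + 4` points of `G` lie within distance `T` of any given point;
* `exists_junctionFinset` — the midpoints of the `A`–`B` edges of an admissible datum `E` and of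
  its translate `shiftData E w` form a set `J` of at most four points, and
  `z ∈ ufrsMarkedNbhd E w ρ' ↔ ∃ m ∈ J, dist m z ≤ ρ'`.

References: G. Grimmett, *Percolation* (1999), §11.8 (renormalisation boxes along a curve);
S. Smirnov, C. R. Acad. Sci. Paris 333 (2001), §2.
-/

namespace Summit.CriticalPhenomena.CardyFormulaZ2.Cruxes.EdgePrecompact.QkzStripBoundaryArm

open MeasureTheory Filter Set Metric
open scoped Topology BigOperators Pointwise
open Literature.Probability.LatticeModels Literature.Probability.Percolation
open Literature.Probability.RandomPlanarGeometry (DobrushinDomain)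
open Summit.CriticalPhenomena.CardyFormulaZ2.Theses.CardyComplexCone

noncomputable section

/-! ## One-dimensional grids -/

/-- The step of the grid of `[y₀, y₁]` at resolution `η`: positive, at most `η`, and at least `η/2`
when `η ≤ y₁ - y₀`. -/
theorem gridStep_bounds {y₀ y₁ η : ℝ} (hy : y₀ < y₁) (hη : 0 < η) :
    0 < (y₁ - y₀) / ⌈(y₁ - y₀) / η⌉₊ ∧ (y₁ - y₀) / ⌈(y₁ - y₀) / η⌉₊ ≤ η ∧
      (η ≤ y₁ - y₀ → η / 2 ≤ (y₁ - y₀) / ⌈(y₁ - y₀) / η⌉₊) := by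
  have hL : 0 < y₁ - y₀ := sub_pos.2 hy
  have hn : (0 : ℝ) < ⌈(y₁ - y₀) / η⌉₊ := by exact_mod_cast Nat.ceil_pos.2 (div_pos hL hη)
  refine ⟨div_pos hL hn, ?_, fun hηL => ?_⟩
  · rw [div_le_iff₀ hn]
    have h1 := Nat.le_ceil ((y₁ - y₀) / η)
    rw [div_le_iff₀ hη] at h1
    linarith
  · rw [le_div_iff₀ hn]
    have h1 := Nat.ceil_lt_add_one (div_pos hL hη).le
    have h2 : (⌈(y₁ - y₀) / η⌉₊ : ℝ) * η < y₁ - y₀ + η := by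
      rw [div_add_one hη.ne', lt_div_iff₀ hη] at h1
      linarith
    nlinarith

/-- **Density of the grid.** Every `b ∈ [y₀, y₁)` is within `η` of a grid point `y₀ + j s`,
`j ≤ ⌈(y₁ - y₀)/η⌉`, `s = (y₁ - y₀)/⌈(y₁ - y₀)/η⌉`. -/
theorem exists_gridIndex {y₀ y₁ η : ℝ} (hy : y₀ < y₁) (hη : 0 < η) {b : ℝ} (hb0 : y₀ ≤ b) (hb1 : b < y₁) :
    ∃ j ∈ Finset.range (⌈(y₁ - y₀) / η⌉₊ + 1),
      |b - (y₀ + j * ((y₁ - y₀) / ⌈(y₁ - y₀) / η⌉₊))| < η := by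
  obtain ⟨hs, hsη, -⟩ := gridStep_bounds hy hη
  set s := (y₁ - y₀) / ⌈(y₁ - y₀) / η⌉₊ with hsdef
  have hn : (0 : ℝ) < ⌈(y₁ - y₀) / η⌉₊ := by
    exact_mod_cast Nat.ceil_pos.2 (div_pos (sub_pos.2 hy) hη)
  have hns : (⌈(y₁ - y₀) / η⌉₊ : ℝ) * s = y₁ - y₀ := by
    rw [hsdef]; field_simp
  refine ⟨⌊(b - y₀) / s⌋₊, ?_, ?_⟩
  · rw [Finset.mem_range]
    have h1 : (⌊(b - y₀) / s⌋₊ : ℝ) ≤ (b - y₀) / s := Nat.floor_le (div_nonneg (sub_nonneg.2 hb0) hs.le)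
    have h2 : (b - y₀) / s < ⌈(y₁ - y₀) / η⌉₊ := by
      rw [div_lt_iff₀ hs]; linarith
    have h3 : (⌊(b - y₀) / s⌋₊ : ℝ) < ⌈(y₁ - y₀) / η⌉₊ := h1.trans_lt h2
    have h4 : ⌊(b - y₀) / s⌋₊ < ⌈(y₁ - y₀) / η⌉₊ := by exact_mod_cast h3
    omega
  · have h1 : (⌊(b - y₀) / s⌋₊ : ℝ) ≤ (b - y₀) / s := Nat.floor_le (div_nonneg (sub_nonneg.2 hb0) hs.le)
    have h2 : (b - y₀) / s < ⌊(b - y₀) / s⌋₊ + 1 := Nat.lt_floor_add_one _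
    rw [le_div_iff₀ hs] at h1
    rw [div_lt_iff₀ hs] at h2
    rw [abs_lt]
    constructor <;> nlinarith

/-- **Counting.** If the `i`-th point of a sequence is, from `m`, at least as far as `|x₀ + i s - c|`
(`s > 0`), then at most `2T/s + 1` of the first `n` points lie within distance `T ≥ 0` of `m`. -/
theorem card_filter_dist_le (f : ℕ → ℂ) (m : ℂ) {x₀ s c T : ℝ} (hs : 0 < s) (hT : 0 ≤ T) (n : ℕ)
    (hf : ∀ i : ℕ, |x₀ + i * s - c| ≤ dist (f i) m) :
    ((((Finset.range n).image f).filter (fun p => dist p m ≤ T)).card : ℝ) ≤ 2 * T / s + 1 := by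
  classical
  set S := (Finset.range n).filter (fun i : ℕ => |x₀ + i * s - c| ≤ T) with hS
  have hsub : ((Finset.range n).image f).filter (fun p => dist p m ≤ T) ⊆ S.image f := by
    intro p hp
    rw [Finset.mem_filter, Finset.mem_image] at hp
    obtain ⟨⟨i, hi, rfl⟩, hp⟩ := hp
    exact Finset.mem_image.2 ⟨i, Finset.mem_filter.2 ⟨hi, (hf i).trans hp⟩, rfl⟩
  have hcard : (((Finset.range n).image f).filter (fun p => dist p m ≤ T)).card ≤ S.card :=
    (Finset.card_le_card hsub).trans Finset.card_image_le
  have hScard : (S.card : ℝ) ≤ 2 * T / s + 1 := by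
    rcases S.eq_empty_or_nonempty with hSe | hSne
    · rw [hSe, Finset.card_empty, Nat.cast_zero]; positivity
    · obtain ⟨i₀, hi₀, hmin⟩ := S.exists_min_image (fun i => i) hSne
      obtain ⟨i₁, hi₁, hmax⟩ := S.exists_max_image (fun i => i) hSne
      have hIcc : S ⊆ Finset.Icc i₀ i₁ := fun i hi => Finset.mem_Icc.2 ⟨hmin i hi, hmax i hi⟩
      have h1 : S.card ≤ i₁ + 1 - i₀ := (Finset.card_le_card hIcc).trans (Nat.card_Icc i₀ i₁).le
      have h0 : |x₀ + (i₀ : ℝ) * s - c| ≤ T := (Finset.mem_filter.1 hi₀).2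
      have h1' : |x₀ + (i₁ : ℝ) * s - c| ≤ T := (Finset.mem_filter.1 hi₁).2
      have hi₀₁ : i₀ ≤ i₁ := hmin i₁ hi₁
      have h2 : ((i₁ : ℝ) - i₀) * s ≤ 2 * T := by
        have := (abs_le.1 h0).1; have := (abs_le.1 h1').2; nlinarith
      have h3 : (i₁ : ℝ) - i₀ ≤ 2 * T / s := by rw [le_div_iff₀ hs]; exact h2
      have h4 : (S.card : ℝ) ≤ (i₁ : ℝ) + 1 - i₀ := by
        have : ((i₁ + 1 - i₀ : ℕ) : ℝ) = (i₁ : ℝ) + 1 - i₀ := by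
          rw [Nat.cast_sub (by omega)]; push_cast; ring
        rw [← this]; exact_mod_cast h1
      linarith
  exact (Nat.cast_le.2 hcard).trans hScard

/-! ## The boundary grid of a rectangle -/

/-- **A point of an open rectangle close to its complement is close to one of the four sides.** -/
theorem near_side_of_infDist_lt {x₀ x₁ y₀ y₁ t : ℝ} {z : ℂ}
    (ht : infDist z (Set.Ioo x₀ x₁ ×ℂ Set.Ioo y₀ y₁)ᶜ < t) :
    z.re - x₀ < t ∨ x₁ - z.re < t ∨ z.im - y₀ < t ∨ y₁ - z.im < t := by
  have abs_re_sub_le_dist : ∀ p m : ℂ, |p.re - m.re| ≤ dist p m := fun p m => by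
    rw [Complex.dist_eq, ← Complex.sub_re]; exact Complex.abs_re_le_norm _
  have abs_im_sub_le_dist : ∀ p m : ℂ, |p.im - m.im| ≤ dist p m := fun p m => by
    rw [Complex.dist_eq, ← Complex.sub_im]; exact Complex.abs_im_le_norm _
  by_contra h
  simp only [not_or, not_lt] at h
  obtain ⟨h1, h2, h3, h4⟩ := h
  have hne : (Set.Ioo x₀ x₁ ×ℂ Set.Ioo y₀ y₁)ᶜ.Nonempty := by
    refine ⟨(x₀ : ℂ), fun hx => ?_⟩
    have := ((Complex.mem_reProdIm).1 hx).1.1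
    simp at this
  have key : t ≤ infDist z (Set.Ioo x₀ x₁ ×ℂ Set.Ioo y₀ y₁)ᶜ := by
    refine (le_infDist hne).2 fun y hy => ?_
    by_contra hlt
    rw [not_le] at hlt
    apply hy
    have hre := abs_lt.1 ((abs_re_sub_le_dist z y).trans_lt hlt)
    have him := abs_lt.1 ((abs_im_sub_le_dist z y).trans_lt hlt)
    rw [Complex.mem_reProdIm, Set.mem_Ioo, Set.mem_Ioo]
    refine ⟨⟨?_, ?_⟩, ?_, ?_⟩ <;> linarith [hre.1, hre.2, him.1, him.2]
  linarith

/-- **The boundary grid of a rectangle.** For an open rectangle `(x₀, x₁) × (y₀, y₁)` with sides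
`≥ η > 0` there is a finite set `G` of boundary points, of cardinality at most
`(2(x₁ - x₀) + 2(y₁ - y₀))/η + 8`, such that every point of the rectangle within `3η` of the
complement is within `4η` of `G`, and at most `16 T/η + 4` points of `G` lie within `T ≥ 0` of any
point of the plane (points of the sides at spacing between `η/2` and `η`). -/
theorem exists_boundaryGrid : ∀ (x₀ x₁ y₀ y₁ η : ℝ), x₀ < x₁ → y₀ < y₁ → 0 < η → η ≤ x₁ - x₀ → η ≤ y₁ - y₀ → ∃ G : Finset ℂ, (∀ p ∈ G, p ∈ frontier (Set.Ioo x₀ x₁ ×ℂ Set.Ioo y₀ y₁)) ∧ ((G.card : ℝ) ≤ (2 * (x₁ - x₀) + 2 * (y₁ - y₀)) / η + 8) ∧ (∀ z ∈ Set.Ioo x₀ x₁ ×ℂ Set.Ioo y₀ y₁, infDist z (Set.Ioo x₀ x₁ ×ℂ Set.Ioo y₀ y₁)ᶜ < 3 * η → ∃ p ∈ G, dist z p < 4 * η) ∧ (∀ (m : ℂ) (T : ℝ), 0 ≤ T → ((G.filter (fun p => dist p m ≤ T)).card : ℝ) ≤ 16 * T / η + 4) := by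
  intro x₀ x₁ y₀ y₁ η hx hy hη hηx hηy
  classical
  have abs_re_sub_le_dist : ∀ p m : ℂ, |p.re - m.re| ≤ dist p m := fun p m => by
    rw [Complex.dist_eq, ← Complex.sub_re]; exact Complex.abs_re_le_norm _
  have abs_im_sub_le_dist : ∀ p m : ℂ, |p.im - m.im| ≤ dist p m := fun p m => by
    rw [Complex.dist_eq, ← Complex.sub_im]; exact Complex.abs_im_le_norm _
  have dist_le_abs_re_add_abs_im : ∀ p m : ℂ, dist p m ≤ |p.re - m.re| + |p.im - m.im| := fun p m => by
    rw [Complex.dist_eq, ← Complex.sub_re, ← Complex.sub_im]; exact Complex.norm_le_abs_re_add_abs_im _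
  obtain ⟨hsx, hsxη, hsx2⟩ := gridStep_bounds hx hη
  obtain ⟨hsy, hsyη, hsy2⟩ := gridStep_bounds hy hη
  have hsx2 := hsx2 hηx
  have hsy2 := hsy2 hηy
  set nx := ⌈(x₁ - x₀) / η⌉₊ with hnx
  set ny := ⌈(y₁ - y₀) / η⌉₊ with hny
  set sx := (x₁ - x₀) / nx with hsxdef
  set sy := (y₁ - y₀) / ny with hsydef
  have hnx0 : (0 : ℝ) < nx := by exact_mod_cast Nat.ceil_pos.2 (div_pos (sub_pos.2 hx) hη)
  have hny0 : (0 : ℝ) < ny := by exact_mod_cast Nat.ceil_pos.2 (div_pos (sub_pos.2 hy) hη)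
  have hnsx : (nx : ℝ) * sx = x₁ - x₀ := by rw [hsxdef]; field_simp
  have hnsy : (ny : ℝ) * sy = y₁ - y₀ := by rw [hsydef]; field_simp
  set fB : ℕ → ℂ := fun i => ⟨x₀ + i * sx, y₀⟩ with hfB
  set fT : ℕ → ℂ := fun i => ⟨x₀ + i * sx, y₁⟩ with hfT
  set fL : ℕ → ℂ := fun j => ⟨x₀, y₀ + j * sy⟩ with hfL
  set fR : ℕ → ℂ := fun j => ⟨x₁, y₀ + j * sy⟩ with hfR
  set G : Finset ℂ := (Finset.range (nx + 1)).image fB ∪ (Finset.range (nx + 1)).image fT ∪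
    (Finset.range (ny + 1)).image fL ∪ (Finset.range (ny + 1)).image fR with hG
  -- grid abscissae / ordinates stay in the closed sides
  have hIx : ∀ i ∈ Finset.range (nx + 1), x₀ + (i : ℝ) * sx ∈ Set.Icc x₀ x₁ := by
    intro i hi
    have hi' : (i : ℝ) ≤ nx := by exact_mod_cast Nat.lt_succ_iff.1 (Finset.mem_range.1 hi)
    refine ⟨by nlinarith, ?_⟩
    nlinarith
  have hIy : ∀ j ∈ Finset.range (ny + 1), y₀ + (j : ℝ) * sy ∈ Set.Icc y₀ y₁ := by
    intro j hj
    have hj' : (j : ℝ) ≤ ny := by exact_mod_cast Nat.lt_succ_iff.1 (Finset.mem_range.1 hj)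
    refine ⟨by nlinarith, ?_⟩
    nlinarith
  have hfront : frontier (Set.Ioo x₀ x₁ ×ℂ Set.Ioo y₀ y₁) =
      Set.Icc x₀ x₁ ×ℂ {y₀, y₁} ∪ {x₀, x₁} ×ℂ Set.Icc y₀ y₁ := by
    rw [Complex.frontier_reProdIm, closure_Ioo hx.ne, closure_Ioo hy.ne, frontier_Ioo hx, frontier_Ioo hy]
  refine ⟨G, fun p hp => ?_, ?_, fun z hz hdist => ?_, fun m T hT => ?_⟩
  · -- boundary points
    rw [hfront]
    simp only [hG, Finset.mem_union, Finset.mem_image] at hp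
    rcases hp with ((⟨i, hi, rfl⟩ | ⟨i, hi, rfl⟩) | ⟨j, hj, rfl⟩) | ⟨j, hj, rfl⟩
    · exact Or.inl (Complex.mem_reProdIm.2 ⟨hIx i hi, by simp [hfB]⟩)
    · exact Or.inl (Complex.mem_reProdIm.2 ⟨hIx i hi, by simp [hfT]⟩)
    · exact Or.inr (Complex.mem_reProdIm.2 ⟨by simp [hfL], hIy j hj⟩)
    · exact Or.inr (Complex.mem_reProdIm.2 ⟨by simp [hfR], hIy j hj⟩)
  · -- cardinality
    have h1 : (G.card : ℝ) ≤ 2 * (nx + 1) + 2 * (ny + 1) := by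
      have := calc G.card
          ≤ ((Finset.range (nx + 1)).image fB ∪ (Finset.range (nx + 1)).image fT ∪
              (Finset.range (ny + 1)).image fL).card + ((Finset.range (ny + 1)).image fR).card :=
            Finset.card_union_le _ _
        _ ≤ (((Finset.range (nx + 1)).image fB ∪ (Finset.range (nx + 1)).image fT).card +
              ((Finset.range (ny + 1)).image fL).card) + ((Finset.range (ny + 1)).image fR).card := by
            gcongr; exact Finset.card_union_le _ _
        _ ≤ ((((Finset.range (nx + 1)).image fB).card + ((Finset.range (nx + 1)).image fT).card) +
              ((Finset.range (ny + 1)).image fL).card) + ((Finset.range (ny + 1)).image fR).card := by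
            gcongr; exact Finset.card_union_le _ _
        _ ≤ (((nx + 1) + (nx + 1)) + (ny + 1)) + (ny + 1) := by
            gcongr <;> exact Finset.card_image_le.trans (Finset.card_range _).le
      have h' : (G.card : ℝ) ≤ (((nx + 1) + (nx + 1)) + (ny + 1) + (ny + 1) : ℕ) := by exact_mod_cast this
      push_cast at h'; linarith
    have h2 : (nx : ℝ) < (x₁ - x₀) / η + 1 := Nat.ceil_lt_add_one (div_pos (sub_pos.2 hx) hη).le
    have h3 : (ny : ℝ) < (y₁ - y₀) / η + 1 := Nat.ceil_lt_add_one (div_pos (sub_pos.2 hy) hη).le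
    have h4 : (2 * (x₁ - x₀) + 2 * (y₁ - y₀)) / η = 2 * ((x₁ - x₀) / η) + 2 * ((y₁ - y₀) / η) := by ring
    rw [h4]; linarith
  · -- covering of the collar
    obtain ⟨⟨hzx0, hzx1⟩, hzy0, hzy1⟩ := Complex.mem_reProdIm.1 hz
    have hmem : ∀ p, (p ∈ (Finset.range (nx + 1)).image fB ∨ p ∈ (Finset.range (nx + 1)).image fT ∨
        p ∈ (Finset.range (ny + 1)).image fL ∨ p ∈ (Finset.range (ny + 1)).image fR) → p ∈ G := by
      intro p hp
      simp only [hG, Finset.mem_union]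
      tauto
    rcases near_side_of_infDist_lt hdist with h | h | h | h
    · obtain ⟨j, hj, hjb⟩ := exists_gridIndex hy hη hzy0.le hzy1
      refine ⟨fL j, hmem _ (Or.inr (Or.inr (Or.inl (Finset.mem_image.2 ⟨j, hj, rfl⟩)))), ?_⟩
      refine (dist_le_abs_re_add_abs_im _ _).trans_lt ?_
      have : |z.re - (fL j).re| < 3 * η := by simp only [hfL]; rw [abs_of_pos (by linarith)]; exact h
      have : |z.im - (fL j).im| < η := by simpa [hfL] using hjb
      linarith
    · obtain ⟨j, hj, hjb⟩ := exists_gridIndex hy hη hzy0.le hzy1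
      refine ⟨fR j, hmem _ (Or.inr (Or.inr (Or.inr (Finset.mem_image.2 ⟨j, hj, rfl⟩)))), ?_⟩
      refine (dist_le_abs_re_add_abs_im _ _).trans_lt ?_
      have : |z.re - (fR j).re| < 3 * η := by simp only [hfR]; rw [abs_of_neg (by linarith)]; linarith
      have : |z.im - (fR j).im| < η := by simpa [hfR] using hjb
      linarith
    · obtain ⟨i, hi, hib⟩ := exists_gridIndex hx hη hzx0.le hzx1
      refine ⟨fB i, hmem _ (Or.inl (Finset.mem_image.2 ⟨i, hi, rfl⟩)), ?_⟩
      refine (dist_le_abs_re_add_abs_im _ _).trans_lt ?_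
      have : |z.re - (fB i).re| < η := by simpa [hfB] using hib
      have : |z.im - (fB i).im| < 3 * η := by simp only [hfB]; rw [abs_of_pos (by linarith)]; exact h
      linarith
    · obtain ⟨i, hi, hib⟩ := exists_gridIndex hx hη hzx0.le hzx1
      refine ⟨fT i, hmem _ (Or.inr (Or.inl (Finset.mem_image.2 ⟨i, hi, rfl⟩))), ?_⟩
      refine (dist_le_abs_re_add_abs_im _ _).trans_lt ?_
      have : |z.re - (fT i).re| < η := by simpa [hfT] using hib
      have : |z.im - (fT i).im| < 3 * η := by simp only [hfT]; rw [abs_of_neg (by linarith)]; linarith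
      linarith
  · -- counting
    have hB := card_filter_dist_le fB m (x₀ := x₀) (c := m.re) hsx hT (nx + 1)
      (fun i => by simpa [hfB] using abs_re_sub_le_dist (fB i) m)
    have hT' := card_filter_dist_le fT m (x₀ := x₀) (c := m.re) hsx hT (nx + 1)
      (fun i => by simpa [hfT] using abs_re_sub_le_dist (fT i) m)
    have hL := card_filter_dist_le fL m (x₀ := y₀) (c := m.im) hsy hT (ny + 1)
      (fun j => by simpa [hfL] using abs_im_sub_le_dist (fL j) m)
    have hR := card_filter_dist_le fR m (x₀ := y₀) (c := m.im) hsy hT (ny + 1)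
      (fun j => by simpa [hfR] using abs_im_sub_le_dist (fR j) m)
    have hsum : ((G.filter (fun p => dist p m ≤ T)).card : ℝ) ≤
        (2 * T / sx + 1) + (2 * T / sx + 1) + (2 * T / sy + 1) + (2 * T / sy + 1) := by
      have h : (G.filter (fun p => dist p m ≤ T)).card ≤
          (((Finset.range (nx + 1)).image fB).filter (fun p => dist p m ≤ T)).card +
            (((Finset.range (nx + 1)).image fT).filter (fun p => dist p m ≤ T)).card +
            (((Finset.range (ny + 1)).image fL).filter (fun p => dist p m ≤ T)).card +
            (((Finset.range (ny + 1)).image fR).filter (fun p => dist p m ≤ T)).card := by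
        simp only [hG, Finset.filter_union]
        refine (Finset.card_union_le _ _).trans ?_
        gcongr
        refine (Finset.card_union_le _ _).trans ?_
        gcongr
        exact Finset.card_union_le _ _
      have h' : ((G.filter (fun p => dist p m ≤ T)).card : ℝ) ≤
          ((((Finset.range (nx + 1)).image fB).filter (fun p => dist p m ≤ T)).card : ℝ) +
            (((Finset.range (nx + 1)).image fT).filter (fun p => dist p m ≤ T)).card +
            (((Finset.range (ny + 1)).image fL).filter (fun p => dist p m ≤ T)).card +
            (((Finset.range (ny + 1)).image fR).filter (fun p => dist p m ≤ T)).card := by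
        exact_mod_cast h
      linarith
    have h1 : 2 * T / sx ≤ 4 * T / η := by
      rw [div_le_div_iff₀ hsx hη]; nlinarith
    have h2 : 2 * T / sy ≤ 4 * T / η := by
      rw [div_le_div_iff₀ hsy hη]; nlinarith
    have h3 : 16 * T / η = 4 * (4 * T / η) := by ring
    linarith


/-! ## The marked midpoints -/

/-- **The marked midpoints.** For admissible `E`, the midpoints of the `A`–`B` edges of `E` and of
its translate `shiftData E w` (two each) form a set `J` of at most four points of the plane, and the
neighbourhood `ufrsMarkedNbhd E w ρ'` of the marked edges is the union of the closed `ρ'`-balls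
around the points of `J`. -/
theorem exists_junctionFinset {E : DiscreteDobrushin} (hE : E.IsZdAdmissible) (w : Site 2) :
    ∃ J : Finset ℂ, J.card ≤ 4 ∧
      ∀ (z : ℂ) (ρ' : ℝ), (z ∈ ufrsMarkedNbhd E w ρ' ↔ ∃ m ∈ J, dist m z ≤ ρ') := by
  classical
  obtain ⟨e₁, e₂, -, h12⟩ := Set.ncard_eq_two.1 hE.ncard_zdABEdges_eq_two
  obtain ⟨e₃, e₄, -, h34⟩ := Set.ncard_eq_two.1 (isZdAdmissible_shiftData E w hE).ncard_zdABEdges_eq_two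
  refine ⟨{medialPoint E.δ e₁, medialPoint E.δ e₂, medialPoint E.δ e₃, medialPoint E.δ e₄},
    Finset.card_le_four, fun z ρ' => ?_⟩
  rw [mem_ufrsMarkedNbhd_iff, h12, h34]
  simp only [Set.mem_insert_iff, Set.mem_singleton_iff, Finset.mem_insert, Finset.mem_singleton]
  constructor
  · rintro ⟨e₀, he, h⟩
    rcases he with (rfl | rfl) | (rfl | rfl)
    · exact ⟨_, Or.inl rfl, h⟩
    · exact ⟨_, Or.inr (Or.inl rfl), h⟩
    · exact ⟨_, Or.inr (Or.inr (Or.inl rfl)), h⟩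
    · exact ⟨_, Or.inr (Or.inr (Or.inr rfl)), h⟩
  · rintro ⟨m, hm, h⟩
    rcases hm with rfl | rfl | rfl | rfl
    · exact ⟨e₁, Or.inl (Or.inl rfl), h⟩
    · exact ⟨e₂, Or.inl (Or.inr rfl), h⟩
    · exact ⟨e₃, Or.inr (Or.inl rfl), h⟩
    · exact ⟨e₄, Or.inr (Or.inr rfl), h⟩


end

end Summit.CriticalPhenomena.CardyFormulaZ2.Cruxes.EdgePrecompact.QkzStripBoundaryArm
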